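import Summits.BirchSwinnertonDyer.BirchSwinnertonDyer.Theorems.BiquadraticEisensteinDescentSignTableCoversDefs
import Summits.BirchSwinnertonDyer.BirchSwinnertonDyer.Theorems.BiquadraticEisensteinDescentHeegnerTwistCouplingInSupplySymbolicMonskyRealise
import HarnessLib

set_option linter.dupNamespace false -- `Summit.BirchSwinnertonDyer.BirchSwinnertonDyer.Theorems.…` (summit = sub)
set_option autoImplicit false

/-!
# Crux `HeegnerTwistCouplingInSupply` (stmt-BirchSwinnertonDyer-21381), crux idea `sign-table-character-dichotomy`:
# the COMPLETION LEMMA of the sign-table game IS A KERNEL THEOREM — part 2: the 8 root-number `−1` base configurations of the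
# EVEN two-parameter base `E_{2pr}` (part 1, `…SignTableCompletion.lean`: `E_p`, `E_{2p}`, `E_{pr}`)

Cell `pub/bsd-wall`, width-prover seat `bsd-wall-cm-bed-w3` g18 (explicit-unit; helper for stmt-BirchSwinnertonDyer-21381, closes
nothing). THE GAME (card §Lever; DATA-seat2-g24 §Model): base `n₀ = p·r` (odd) or `2·p·r` (or `p`, `2p`), `p ≡ 3 (mod 4)` the CM-inert
additive prime of `W = E_{n₀} : y² = x³ − n₀² x`, root number `−1`; the Heegner twist is `d = −q₁⋯q_t` by auxiliary primes `q_i` whose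
CELLS `(q_i mod 8, (q_i/r))` and mutual symbols `(q_j/q_i)` the prover chooses, while the column `(q_i/p)` is an adversary's SIGN
TABLE `σ : cells → {±1}`; the prover WINS if `q₁⋯q_t ≡ 7 (8)`, `(d/p) = (d/r) = +1` (Heegner for `32 n₀²` / `16 n₀²`) and Monsky's
matrix of `n₀·q₁⋯q_t` [HeathBrown1994, appendix (Monsky); tree `HeathBrown1994.monskyMatrixOdd/Even`] is invertible over `𝔽₂`
(`s(n₀|d|) = 0`, whence `#Sel₂(E_{n₀|d|}) = 4` by the tree's PROVED Monsky theorem, and `L(E_{n₀}^{(d)}, 1) ≠ 0` modulo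
Burungale–Tian, by the tree's doors — not restated here).

PROVED HERE, by `decide +kernel` over the recipe covers of `BiquadraticEisensteinDescentSignTableCoversDefs.lean` (296 recipes):
* `cover…_wins` — EVERY recipe of every cover WINS: Heegner parities and `detCheckOdd/Even = true` of the symbolic Monsky matrix
  of `(p, r, q₁, …, q_t)` built from the base classes, the cells, the assumed signs and the chosen mutual symbols (the check is a
  VERIFIED `𝔽₂` product against an in-kernel Gauss–Jordan candidate inverse; soundness `…SymbolicMonskySound.lean`).
* `cover…_complete` — EVERY sign table `σ` on the cells (bitmask `σ < 2⁸`, bit `cellIdx c` = `[(q/p) = −1]` on cell `c`)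
  is either a CHARACTER of the cell group (`isCharK0`: `1, χ₋₄, χ₈, χ₋₈`; `isCharK1`: the `8` characters `ψ(a)·e^s` of
  `(ℤ/8)ˣ × {±1}`) or is beaten by a recipe of the cover whose assumed signs are `σ`'s (`Recipe.applies`).
  Together: **the prover beats every non-character table with `t ≤ 4` auxiliary primes (`t ≤ 5` on `E_{pr}`, `p ≡ 7`, `r ≡ 1 (8)`,
  `(r/p) = +1`)** — the census of DATA-seat2-g24.md for `k = 0, 1`, now kernel-checked (characters CAN be fatal: e.g. the tables
  `1, χ₋₄, χ₈` on `E_p` — not needed here and not decided here).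
* `cover…_realised` — the MEANING for actual primes (via `…SymbolicMonskyRealise.lean`): any primes `(p, r, q₁, …, q_t)` realising a
  recipe of the cover (classes, `(r/p)`, the cells' `(q_i/r)`, the table's `(q_i/p)`, the mutual `(q_j/q_i)`) have
  `det (monskyMatrixOdd/Even (p, r, q…)) = 1`, `q₁⋯q_t ≡ 7 (mod 8)`, `(−q₁⋯q_t/p) = +1`, `(−q₁⋯q_t/r) = +1`.

HONEST LIMITS (card §Transfer/§Barriers): this is the finite combinatorial core only. The SUPPLY of small primes realising a winning
recipe for the actual column `q ↦ (q/p)` (Dirichlet cells + Burgess/Vinogradov exclusion of character columns below `p^{0.26}` +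
a bilinear sieve for the mutual symbols, with `√|d| log|d| < πp` for `h(ℚ(√d)) < p`) is the card's analytic input, untyped; the
method says nothing for CM curves with `E[2]` irreducible; the crux as stated (C⁺, `stub_nonNullIndivisibleHeegner`) and BSD are NOT
touched; nothing is closed by this file. THEOREMS ONLY. Supports stmt-BirchSwinnertonDyer-21381.
-/

namespace Summit.BirchSwinnertonDyer.BirchSwinnertonDyer.Theorems.SymbolicMonsky

open Matrix Literature.NumberTheory.EllipticCurves Literature.NumberTheory.EllipticCurves.HeathBrown1994
  Literature.NumberTheory.EllipticCurves.HeathBrown1994.Families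

/-- **Every recipe of `cover2PR31p` wins** (base `E_{2pr}`, `p ≡ 3`, `r ≡ 1 (mod 8)`, `(r/p) = +1`; 26 recipes, `t ≤ 4`): Heegner parities and `det = 1` of the symbolic
Monsky matrix, decided by the kernel. -/
theorem cover2PR31p_wins : cover2PR31p.all (fun rcp => rcp.wins2PR 1 0 false) = true := by
  decide +kernel

/-- **Completion for base `E_{2pr}`, `p ≡ 3`, `r ≡ 1 (mod 8)`, `(r/p) = +1`**: every sign table on the 8 cells is a character or is beaten by a recipe of
`cover2PR31p`. -/
theorem cover2PR31p_complete : ∀ σ < 256, isCharK1 σ = true ∨ cover2PR31p.any (Recipe.applies σ) = true := by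
  decide +kernel

/-- **Meaning for actual primes** (base `E_{2pr}`, `p ≡ 3`, `r ≡ 1 (mod 8)`, `(r/p) = +1`): primes `(p, r, q₁, …, q_t)` realising a recipe of `cover2PR31p` have
`det M = 1` for Monsky's even matrix of `2·p·r·q₁⋯q_t`, and `2`, `p`, `r` split in `ℚ(√−q₁⋯q_t)`. -/
theorem cover2PR31p_realised {rcp : Recipe} (hr : rcp ∈ cover2PR31p) {p r : ℕ} {q : Fin rcp.t → ℕ} (h : rcp.RealisesK1 1 0 false p r q) :
    (monskyMatrixEven (Fin.cons p (Fin.cons r q) : Fin (rcp.t + 2) → ℕ)).det = 1 ∧ (∏ i, q i) % 8 = 7 ∧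
      jacobiSym (-((∏ i, q i : ℕ) : ℤ)) p = 1 ∧ jacobiSym (-((∏ i, q i : ℕ) : ℤ)) r = 1 := by
  have hw : rcp.wins2PR 1 0 false = true := List.all_eq_true.mp cover2PR31p_wins rcp hr
  have hh : rcp.heegner 1 (some 0) = true := by
    simp only [Recipe.wins2PR, Bool.and_eq_true] at hw
    exact hw.1
  exact ⟨h.det_even hw, h.prod_mod_eight hh, h.jacobiSym_neg_prod_p hh, h.jacobiSym_neg_prod_r hh⟩

/-- **Every recipe of `cover2PR31m` wins** (base `E_{2pr}`, `p ≡ 3`, `r ≡ 1 (mod 8)`, `(r/p) = −1`; 14 recipes, `t ≤ 4`): Heegner parities and `det = 1` of the symbolic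
Monsky matrix, decided by the kernel. -/
theorem cover2PR31m_wins : cover2PR31m.all (fun rcp => rcp.wins2PR 1 0 true) = true := by
  decide +kernel

/-- **Completion for base `E_{2pr}`, `p ≡ 3`, `r ≡ 1 (mod 8)`, `(r/p) = −1`**: every sign table on the 8 cells is a character or is beaten by a recipe of
`cover2PR31m`. -/
theorem cover2PR31m_complete : ∀ σ < 256, isCharK1 σ = true ∨ cover2PR31m.any (Recipe.applies σ) = true := by
  decide +kernel

/-- **Meaning for actual primes** (base `E_{2pr}`, `p ≡ 3`, `r ≡ 1 (mod 8)`, `(r/p) = −1`): primes `(p, r, q₁, …, q_t)` realising a recipe of `cover2PR31m` have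
`det M = 1` for Monsky's even matrix of `2·p·r·q₁⋯q_t`, and `2`, `p`, `r` split in `ℚ(√−q₁⋯q_t)`. -/
theorem cover2PR31m_realised {rcp : Recipe} (hr : rcp ∈ cover2PR31m) {p r : ℕ} {q : Fin rcp.t → ℕ} (h : rcp.RealisesK1 1 0 true p r q) :
    (monskyMatrixEven (Fin.cons p (Fin.cons r q) : Fin (rcp.t + 2) → ℕ)).det = 1 ∧ (∏ i, q i) % 8 = 7 ∧
      jacobiSym (-((∏ i, q i : ℕ) : ℤ)) p = 1 ∧ jacobiSym (-((∏ i, q i : ℕ) : ℤ)) r = 1 := by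
  have hw : rcp.wins2PR 1 0 true = true := List.all_eq_true.mp cover2PR31m_wins rcp hr
  have hh : rcp.heegner 1 (some 0) = true := by
    simp only [Recipe.wins2PR, Bool.and_eq_true] at hw
    exact hw.1
  exact ⟨h.det_even hw, h.prod_mod_eight hh, h.jacobiSym_neg_prod_p hh, h.jacobiSym_neg_prod_r hh⟩

/-- **Every recipe of `cover2PR35p` wins** (base `E_{2pr}`, `p ≡ 3`, `r ≡ 5 (mod 8)`, `(r/p) = +1`; 14 recipes, `t ≤ 4`): Heegner parities and `det = 1` of the symbolic
Monsky matrix, decided by the kernel. -/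
theorem cover2PR35p_wins : cover2PR35p.all (fun rcp => rcp.wins2PR 1 2 false) = true := by
  decide +kernel

/-- **Completion for base `E_{2pr}`, `p ≡ 3`, `r ≡ 5 (mod 8)`, `(r/p) = +1`**: every sign table on the 8 cells is a character or is beaten by a recipe of
`cover2PR35p`. -/
theorem cover2PR35p_complete : ∀ σ < 256, isCharK1 σ = true ∨ cover2PR35p.any (Recipe.applies σ) = true := by
  decide +kernel

/-- **Meaning for actual primes** (base `E_{2pr}`, `p ≡ 3`, `r ≡ 5 (mod 8)`, `(r/p) = +1`): primes `(p, r, q₁, …, q_t)` realising a recipe of `cover2PR35p` have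
`det M = 1` for Monsky's even matrix of `2·p·r·q₁⋯q_t`, and `2`, `p`, `r` split in `ℚ(√−q₁⋯q_t)`. -/
theorem cover2PR35p_realised {rcp : Recipe} (hr : rcp ∈ cover2PR35p) {p r : ℕ} {q : Fin rcp.t → ℕ} (h : rcp.RealisesK1 1 2 false p r q) :
    (monskyMatrixEven (Fin.cons p (Fin.cons r q) : Fin (rcp.t + 2) → ℕ)).det = 1 ∧ (∏ i, q i) % 8 = 7 ∧
      jacobiSym (-((∏ i, q i : ℕ) : ℤ)) p = 1 ∧ jacobiSym (-((∏ i, q i : ℕ) : ℤ)) r = 1 := by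
  have hw : rcp.wins2PR 1 2 false = true := List.all_eq_true.mp cover2PR35p_wins rcp hr
  have hh : rcp.heegner 1 (some 2) = true := by
    simp only [Recipe.wins2PR, Bool.and_eq_true] at hw
    exact hw.1
  exact ⟨h.det_even hw, h.prod_mod_eight hh, h.jacobiSym_neg_prod_p hh, h.jacobiSym_neg_prod_r hh⟩

/-- **Every recipe of `cover2PR35m` wins** (base `E_{2pr}`, `p ≡ 3`, `r ≡ 5 (mod 8)`, `(r/p) = −1`; 14 recipes, `t ≤ 4`): Heegner parities and `det = 1` of the symbolic
Monsky matrix, decided by the kernel. -/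
theorem cover2PR35m_wins : cover2PR35m.all (fun rcp => rcp.wins2PR 1 2 true) = true := by
  decide +kernel

/-- **Completion for base `E_{2pr}`, `p ≡ 3`, `r ≡ 5 (mod 8)`, `(r/p) = −1`**: every sign table on the 8 cells is a character or is beaten by a recipe of
`cover2PR35m`. -/
theorem cover2PR35m_complete : ∀ σ < 256, isCharK1 σ = true ∨ cover2PR35m.any (Recipe.applies σ) = true := by
  decide +kernel

/-- **Meaning for actual primes** (base `E_{2pr}`, `p ≡ 3`, `r ≡ 5 (mod 8)`, `(r/p) = −1`): primes `(p, r, q₁, …, q_t)` realising a recipe of `cover2PR35m` have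
`det M = 1` for Monsky's even matrix of `2·p·r·q₁⋯q_t`, and `2`, `p`, `r` split in `ℚ(√−q₁⋯q_t)`. -/
theorem cover2PR35m_realised {rcp : Recipe} (hr : rcp ∈ cover2PR35m) {p r : ℕ} {q : Fin rcp.t → ℕ} (h : rcp.RealisesK1 1 2 true p r q) :
    (monskyMatrixEven (Fin.cons p (Fin.cons r q) : Fin (rcp.t + 2) → ℕ)).det = 1 ∧ (∏ i, q i) % 8 = 7 ∧
      jacobiSym (-((∏ i, q i : ℕ) : ℤ)) p = 1 ∧ jacobiSym (-((∏ i, q i : ℕ) : ℤ)) r = 1 := by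
  have hw : rcp.wins2PR 1 2 true = true := List.all_eq_true.mp cover2PR35m_wins rcp hr
  have hh : rcp.heegner 1 (some 2) = true := by
    simp only [Recipe.wins2PR, Bool.and_eq_true] at hw
    exact hw.1
  exact ⟨h.det_even hw, h.prod_mod_eight hh, h.jacobiSym_neg_prod_p hh, h.jacobiSym_neg_prod_r hh⟩

/-- **Every recipe of `cover2PR71p` wins** (base `E_{2pr}`, `p ≡ 7`, `r ≡ 1 (mod 8)`, `(r/p) = +1`; 24 recipes, `t ≤ 4`): Heegner parities and `det = 1` of the symbolic
Monsky matrix, decided by the kernel. -/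
theorem cover2PR71p_wins : cover2PR71p.all (fun rcp => rcp.wins2PR 3 0 false) = true := by
  decide +kernel

/-- **Completion for base `E_{2pr}`, `p ≡ 7`, `r ≡ 1 (mod 8)`, `(r/p) = +1`**: every sign table on the 8 cells is a character or is beaten by a recipe of
`cover2PR71p`. -/
theorem cover2PR71p_complete : ∀ σ < 256, isCharK1 σ = true ∨ cover2PR71p.any (Recipe.applies σ) = true := by
  decide +kernel

/-- **Meaning for actual primes** (base `E_{2pr}`, `p ≡ 7`, `r ≡ 1 (mod 8)`, `(r/p) = +1`): primes `(p, r, q₁, …, q_t)` realising a recipe of `cover2PR71p` have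
`det M = 1` for Monsky's even matrix of `2·p·r·q₁⋯q_t`, and `2`, `p`, `r` split in `ℚ(√−q₁⋯q_t)`. -/
theorem cover2PR71p_realised {rcp : Recipe} (hr : rcp ∈ cover2PR71p) {p r : ℕ} {q : Fin rcp.t → ℕ} (h : rcp.RealisesK1 3 0 false p r q) :
    (monskyMatrixEven (Fin.cons p (Fin.cons r q) : Fin (rcp.t + 2) → ℕ)).det = 1 ∧ (∏ i, q i) % 8 = 7 ∧
      jacobiSym (-((∏ i, q i : ℕ) : ℤ)) p = 1 ∧ jacobiSym (-((∏ i, q i : ℕ) : ℤ)) r = 1 := by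
  have hw : rcp.wins2PR 3 0 false = true := List.all_eq_true.mp cover2PR71p_wins rcp hr
  have hh : rcp.heegner 3 (some 0) = true := by
    simp only [Recipe.wins2PR, Bool.and_eq_true] at hw
    exact hw.1
  exact ⟨h.det_even hw, h.prod_mod_eight hh, h.jacobiSym_neg_prod_p hh, h.jacobiSym_neg_prod_r hh⟩

/-- **Every recipe of `cover2PR71m` wins** (base `E_{2pr}`, `p ≡ 7`, `r ≡ 1 (mod 8)`, `(r/p) = −1`; 16 recipes, `t ≤ 3`): Heegner parities and `det = 1` of the symbolic
Monsky matrix, decided by the kernel. -/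
theorem cover2PR71m_wins : cover2PR71m.all (fun rcp => rcp.wins2PR 3 0 true) = true := by
  decide +kernel

/-- **Completion for base `E_{2pr}`, `p ≡ 7`, `r ≡ 1 (mod 8)`, `(r/p) = −1`**: every sign table on the 8 cells is a character or is beaten by a recipe of
`cover2PR71m`. -/
theorem cover2PR71m_complete : ∀ σ < 256, isCharK1 σ = true ∨ cover2PR71m.any (Recipe.applies σ) = true := by
  decide +kernel

/-- **Meaning for actual primes** (base `E_{2pr}`, `p ≡ 7`, `r ≡ 1 (mod 8)`, `(r/p) = −1`): primes `(p, r, q₁, …, q_t)` realising a recipe of `cover2PR71m` have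
`det M = 1` for Monsky's even matrix of `2·p·r·q₁⋯q_t`, and `2`, `p`, `r` split in `ℚ(√−q₁⋯q_t)`. -/
theorem cover2PR71m_realised {rcp : Recipe} (hr : rcp ∈ cover2PR71m) {p r : ℕ} {q : Fin rcp.t → ℕ} (h : rcp.RealisesK1 3 0 true p r q) :
    (monskyMatrixEven (Fin.cons p (Fin.cons r q) : Fin (rcp.t + 2) → ℕ)).det = 1 ∧ (∏ i, q i) % 8 = 7 ∧
      jacobiSym (-((∏ i, q i : ℕ) : ℤ)) p = 1 ∧ jacobiSym (-((∏ i, q i : ℕ) : ℤ)) r = 1 := by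
  have hw : rcp.wins2PR 3 0 true = true := List.all_eq_true.mp cover2PR71m_wins rcp hr
  have hh : rcp.heegner 3 (some 0) = true := by
    simp only [Recipe.wins2PR, Bool.and_eq_true] at hw
    exact hw.1
  exact ⟨h.det_even hw, h.prod_mod_eight hh, h.jacobiSym_neg_prod_p hh, h.jacobiSym_neg_prod_r hh⟩

/-- **Every recipe of `cover2PR75p` wins** (base `E_{2pr}`, `p ≡ 7`, `r ≡ 5 (mod 8)`, `(r/p) = +1`; 14 recipes, `t ≤ 4`): Heegner parities and `det = 1` of the symbolic
Monsky matrix, decided by the kernel. -/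
theorem cover2PR75p_wins : cover2PR75p.all (fun rcp => rcp.wins2PR 3 2 false) = true := by
  decide +kernel

/-- **Completion for base `E_{2pr}`, `p ≡ 7`, `r ≡ 5 (mod 8)`, `(r/p) = +1`**: every sign table on the 8 cells is a character or is beaten by a recipe of
`cover2PR75p`. -/
theorem cover2PR75p_complete : ∀ σ < 256, isCharK1 σ = true ∨ cover2PR75p.any (Recipe.applies σ) = true := by
  decide +kernel

/-- **Meaning for actual primes** (base `E_{2pr}`, `p ≡ 7`, `r ≡ 5 (mod 8)`, `(r/p) = +1`): primes `(p, r, q₁, …, q_t)` realising a recipe of `cover2PR75p` have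
`det M = 1` for Monsky's even matrix of `2·p·r·q₁⋯q_t`, and `2`, `p`, `r` split in `ℚ(√−q₁⋯q_t)`. -/
theorem cover2PR75p_realised {rcp : Recipe} (hr : rcp ∈ cover2PR75p) {p r : ℕ} {q : Fin rcp.t → ℕ} (h : rcp.RealisesK1 3 2 false p r q) :
    (monskyMatrixEven (Fin.cons p (Fin.cons r q) : Fin (rcp.t + 2) → ℕ)).det = 1 ∧ (∏ i, q i) % 8 = 7 ∧
      jacobiSym (-((∏ i, q i : ℕ) : ℤ)) p = 1 ∧ jacobiSym (-((∏ i, q i : ℕ) : ℤ)) r = 1 := by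
  have hw : rcp.wins2PR 3 2 false = true := List.all_eq_true.mp cover2PR75p_wins rcp hr
  have hh : rcp.heegner 3 (some 2) = true := by
    simp only [Recipe.wins2PR, Bool.and_eq_true] at hw
    exact hw.1
  exact ⟨h.det_even hw, h.prod_mod_eight hh, h.jacobiSym_neg_prod_p hh, h.jacobiSym_neg_prod_r hh⟩

/-- **Every recipe of `cover2PR75m` wins** (base `E_{2pr}`, `p ≡ 7`, `r ≡ 5 (mod 8)`, `(r/p) = −1`; 18 recipes, `t ≤ 4`): Heegner parities and `det = 1` of the symbolic
Monsky matrix, decided by the kernel. -/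
theorem cover2PR75m_wins : cover2PR75m.all (fun rcp => rcp.wins2PR 3 2 true) = true := by
  decide +kernel

/-- **Completion for base `E_{2pr}`, `p ≡ 7`, `r ≡ 5 (mod 8)`, `(r/p) = −1`**: every sign table on the 8 cells is a character or is beaten by a recipe of
`cover2PR75m`. -/
theorem cover2PR75m_complete : ∀ σ < 256, isCharK1 σ = true ∨ cover2PR75m.any (Recipe.applies σ) = true := by
  decide +kernel

/-- **Meaning for actual primes** (base `E_{2pr}`, `p ≡ 7`, `r ≡ 5 (mod 8)`, `(r/p) = −1`): primes `(p, r, q₁, …, q_t)` realising a recipe of `cover2PR75m` have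
`det M = 1` for Monsky's even matrix of `2·p·r·q₁⋯q_t`, and `2`, `p`, `r` split in `ℚ(√−q₁⋯q_t)`. -/
theorem cover2PR75m_realised {rcp : Recipe} (hr : rcp ∈ cover2PR75m) {p r : ℕ} {q : Fin rcp.t → ℕ} (h : rcp.RealisesK1 3 2 true p r q) :
    (monskyMatrixEven (Fin.cons p (Fin.cons r q) : Fin (rcp.t + 2) → ℕ)).det = 1 ∧ (∏ i, q i) % 8 = 7 ∧
      jacobiSym (-((∏ i, q i : ℕ) : ℤ)) p = 1 ∧ jacobiSym (-((∏ i, q i : ℕ) : ℤ)) r = 1 := by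
  have hw : rcp.wins2PR 3 2 true = true := List.all_eq_true.mp cover2PR75m_wins rcp hr
  have hh : rcp.heegner 3 (some 2) = true := by
    simp only [Recipe.wins2PR, Bool.and_eq_true] at hw
    exact hw.1
  exact ⟨h.det_even hw, h.prod_mod_eight hh, h.jacobiSym_neg_prod_p hh, h.jacobiSym_neg_prod_r hh⟩


end Summit.BirchSwinnertonDyer.BirchSwinnertonDyer.Theorems.SymbolicMonsky
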